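import Summits.QuantumFields.BalabanUV.Beta.RemainderExplicitTwoLoopSigned

/-!
# EriceRemainderEnclosureJointLetterProfile — (E26) file 2: THE PROFILE OF THE CANCELLATION FAMILY.  `μ_n = 1∕√(1 + ln(n+1))`, the one-loop proxy
# `F(K) = μ_K·H_K` and the harmonic transform `Tμ(K) = Σ_{n<K} μ_n∕(K − n)`: the SANDWICH `F ≤ Tμ ≤ F + 2`, N3-win for F, null steps, √(ln)-growth
# (row D4 co-owner #2 lineage `b2b-balaban-beta-d4-p2`, generation 28)

HEADER: as file 1 `EriceRemainderEnclosureJointLetter` (cell `pub-balaban`, BINDER row D4, β-FLOW TEAM duty (1), FREEZE (0) honoured — def-free module in the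
lineage's own `Beta/EriceRemainderEnclosure*` series; SOURCE = [BalabanJaffe1986] Part III (3.73)–(3.76) p. 250 as SHAPES ONLY; LETTERS N3-log ∕ N3-win ∕
N4-signed ∕ two-loop log-drift ∕ joint — all NOT-IN-PRINT, declared).  This file is LETTER-LEVEL real analysis with no run and no step function: the
profile `μ_n := 1∕√(1 + ln(n+1))` (antitone, → 0, slowly varying), the real harmonic numbers `H_K := Σ_{i<K} 1∕(i+1)`, the one-loop proxy `F(K) := μ_K·H_K`
and the harmonic transform `Tμ(K) := Σ_{n<K} μ_n∕(K − n)` — all four entering as VARIABLES constrained by their defining equations (hypotheses `hμ hH hF hT`);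
no definition is introduced.  File 3 (`…JointLetterWitness`) builds from them the cancellation family `β_{n,0} = β₀ + θ(F(n+1) − F(n))`, `β_{n,2} = β₂ + β₀θμ_n`
(so `P = θF`, `T = β₀θ·Tμ`, and `P + T∕|β₀| = θ(F − Tμ) ∈ [−2θ, 0]`: the JOINT letter by cancellation, with neither rectangle).

WHAT THIS FILE PROVES ([folklore]; Mathlib's `harmonic_le_one_add_log` ∕ `log_add_one_le_harmonic`, prover 1's `sum_range_reflect_sub`, road P3's
`sum_range_inv_succ_eq_harmonic` BY NAME; 0 sorry, 0 `def`):
* §1 `inv_sqrt_sub_mem` (slow variation of x ↦ 1∕√x on [1, ∞): `0 ≤ 1∕√a − 1∕√b ≤ (b − a)∕(2a√b)`), `one_le_logShift`, `mu_pos_le_one`, `mu_sub_mem`,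
  `mu_tendsto_zero`, `harmonicR_facts` (`H_0 = 0`, `H_{n+1} = H_n + 1∕(n+1)`, `ln(K+1) ≤ H_K ≤ 1 + ln K`, monotone).
* §2 **`F_le_T`, `T_le_F_add_two` — THE SANDWICH `F(K) ≤ Tμ(K) ≤ F(K) + 2`** (lower: μ antitone against `Σ_{n<K} 1∕(K−n) = H_K`; upper: the terms
  `n < ⌊K∕2⌋` cost ≤ 1, the rest ≤ `μ_{⌊K∕2⌋}H_K`, and `(μ_{⌊K∕2⌋} − μ_K)·H_K ≤ 1` by slow variation).
* §3 `F_facts`, **`window_F`** (N3-win for F: `|F(K) − F(n)| ≤ 1 + (ln K − ln n)` for `n ≤ K`, `Real.log 0 = 0` included), `F_step_le`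
  (`|F(n+1) − F(n)| ≤ 1∕(n+1)`), **`F_bounds`** (`√(1 + ln(K+1)) − 1 ≤ F(K) ≤ √(1 + ln(K+1))`).
HONEST: a TOY profile for NOT-IN-PRINT letters; nothing of Bałaban's (1.22) or of Bałaban–Jaffe's β_n asserted, constructed or instantiated; row D4 class
UNCHANGED (critical-path width 0; instance 0∕1; D4 DISCHARGE NO DATE); NOT [Balaban1987RG1] Theorem 2, NOT BetaPertH, NOT continuum, NOT Clay.
HONEST DEPENDENCY: continuum YM on T⁴ ⇐ BetaPertH ∧ nine spine estimates (0/9 proved); BetaPertH ⇐ (D1) ∧ (D4) ∧ CAP+tail; G-an2-4 gates asym, D1 and NE2/3/4.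
-/

noncomputable section

open Finset Real Filter Topology

namespace Summit.QuantumFields.BalabanUV.Beta.EriceRemainderEnclosureJointLetterProfile

open Summit.QuantumFields.BalabanUV.Beta.EriceFlowEnclosureBareCouplingSums (sum_range_reflect_sub)
open Summit.QuantumFields.BalabanUV.Beta.RemainderExplicitLogRate (sum_range_inv_succ_eq_harmonic)

/-! ## §1 The profile μ and the real harmonic numbers -/

/-- **SLOW VARIATION OF x ↦ 1∕√x ON [1, ∞)**: for `1 ≤ a ≤ b`, `0 ≤ 1∕√a − 1∕√b ≤ (b − a)∕(2a√b)` (with x = √a ≤ y = √b: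
`1∕x − 1∕y = (y − x)∕(xy) ≤ (y − x)(y + x)∕(2x²y)` because `2x ≤ x + y`). [folklore] -/
theorem inv_sqrt_sub_mem {a b : ℝ} (ha : 1 ≤ a) (hab : a ≤ b) :
    0 ≤ 1 / Real.sqrt a - 1 / Real.sqrt b ∧ 1 / Real.sqrt a - 1 / Real.sqrt b ≤ (b - a) / (2 * a * Real.sqrt b) := by
  set x := Real.sqrt a with hx
  set y := Real.sqrt b with hy
  have hx1 : 1 ≤ x := Real.one_le_sqrt.mpr ha
  have hxy : x ≤ y := Real.sqrt_le_sqrt hab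
  have hx2 : x ^ 2 = a := Real.sq_sqrt (by linarith)
  have hy2 : y ^ 2 = b := Real.sq_sqrt (by linarith)
  have hx0 : 0 < x := by linarith
  have hy0 : 0 < y := by linarith
  have e1 : 1 / x - 1 / y = (y - x) / (x * y) := by field_simp
  rw [e1, ← hx2, ← hy2]
  refine ⟨div_nonneg (by linarith) (by positivity), ?_⟩
  rw [div_le_div_iff₀ (by positivity) (by positivity)]
  nlinarith [mul_nonneg (mul_nonneg (sq_nonneg (y - x)) hx0.le) hy0.le]

/-- `1 ≤ 1 + ln(n+1) ≤ 1 + ln(K+1)` for `n ≤ K`, and `1 ≤ √(1 + ln(n+1))`. [folklore] -/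
theorem one_le_logShift {n K : ℕ} (hn : n ≤ K) :
    1 ≤ 1 + Real.log ((n : ℝ) + 1) ∧ 1 + Real.log ((n : ℝ) + 1) ≤ 1 + Real.log ((K : ℝ) + 1) ∧
      1 ≤ Real.sqrt (1 + Real.log ((n : ℝ) + 1)) := by
  have hn0 : (0 : ℝ) ≤ n := Nat.cast_nonneg n
  have h0 : 0 ≤ Real.log ((n : ℝ) + 1) := Real.log_nonneg (by linarith)
  have h1 : Real.log ((n : ℝ) + 1) ≤ Real.log ((K : ℝ) + 1) :=
    Real.log_le_log (by linarith) (by exact_mod_cast Nat.add_le_add_right hn 1)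
  exact ⟨by linarith, by linarith, Real.one_le_sqrt.mpr (by linarith)⟩

section profile

variable {μ H F T : ℕ → ℝ}
  (hμ : ∀ n : ℕ, μ n = 1 / Real.sqrt (1 + Real.log ((n : ℝ) + 1)))
  (hH : ∀ K : ℕ, H K = ∑ i ∈ range K, 1 / ((i : ℝ) + 1))
  (hF : ∀ K : ℕ, F K = μ K * H K)
  (hT : ∀ K : ℕ, T K = ∑ n ∈ range K, μ n / ((K : ℝ) - n))

include hμ in
/-- `0 < μ_n ≤ 1`. [folklore] -/
theorem mu_pos_le_one (n : ℕ) : 0 < μ n ∧ μ n ≤ 1 := by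
  have h := (one_le_logShift (le_refl n)).2.2
  rw [hμ n]
  exact ⟨by positivity, (div_le_one (by linarith)).mpr h⟩

include hμ in
/-- μ is antitone and slowly varying: for `n ≤ K`, `0 ≤ μ_n − μ_K ≤ (ln(K+1) − ln(n+1))∕(2(1 + ln(n+1))√(1 + ln(K+1)))`. [folklore] -/
theorem mu_sub_mem {n K : ℕ} (hn : n ≤ K) :
    0 ≤ μ n - μ K ∧ μ n - μ K ≤ (Real.log ((K : ℝ) + 1) - Real.log ((n : ℝ) + 1)) /
      (2 * (1 + Real.log ((n : ℝ) + 1)) * Real.sqrt (1 + Real.log ((K : ℝ) + 1))) := by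
  obtain ⟨ha, hab, _⟩ := one_le_logShift hn
  have h := inv_sqrt_sub_mem ha hab
  have e : 1 + Real.log ((K : ℝ) + 1) - (1 + Real.log ((n : ℝ) + 1)) = Real.log ((K : ℝ) + 1) - Real.log ((n : ℝ) + 1) := by ring
  rw [e] at h
  rw [hμ n, hμ K]
  exact h

include hμ in
/-- `μ_n → 0`. [folklore] -/
theorem mu_tendsto_zero : Tendsto μ atTop (𝓝 0) := by
  have h1 : Tendsto (fun n : ℕ => 1 + Real.log ((n : ℝ) + 1)) atTop atTop :=
    tendsto_atTop_add_const_left _ _ (Real.tendsto_log_atTop.comp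
      (tendsto_atTop_add_const_right _ _ tendsto_natCast_atTop_atTop))
  have h2 := (Real.tendsto_sqrt_atTop.comp h1).inv_tendsto_atTop
  refine h2.congr fun n => ?_
  simp [hμ n, one_div]

include hH in
/-- The real harmonic numbers: `H_0 = 0`, `H_{n+1} = H_n + 1∕(n+1)`, `ln(K+1) ≤ H_K ≤ 1 + ln K` (Mathlib's bounds), `H_n ≤ H_K` for `n ≤ K`. [folklore] -/
theorem harmonicR_facts :
    H 0 = 0 ∧ (∀ n : ℕ, H (n + 1) = H n + 1 / ((n : ℝ) + 1)) ∧ (∀ K : ℕ, Real.log ((K : ℝ) + 1) ≤ H K) ∧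
      (∀ K : ℕ, H K ≤ 1 + Real.log (K : ℝ)) ∧ ∀ n K : ℕ, n ≤ K → H n ≤ H K := by
  refine ⟨by simp [hH], fun n => by rw [hH, hH, sum_range_succ], fun K => ?_, fun K => ?_, fun n K hnK => ?_⟩
  · rw [hH, sum_range_inv_succ_eq_harmonic]
    have := log_add_one_le_harmonic K
    push_cast at this
    exact this
  · rw [hH, sum_range_inv_succ_eq_harmonic]; exact harmonic_le_one_add_log K
  · rw [hH, hH]
    exact sum_le_sum_of_subset_of_nonneg (range_mono hnK) fun i _ _ => by positivity

/-! ## §2 The sandwich `F ≤ Tμ ≤ F + 2` -/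

include hμ hH hF hT in
/-- **LOWER HALF**: `F(K) ≤ Tμ(K)` — every `μ_n` with `n < K` is at least `μ_K`, and `Σ_{n<K} 1∕(K − n) = H_K`. [folklore] -/
theorem F_le_T (K : ℕ) : F K ≤ T K := by
  rw [hF, hT, hH, ← sum_range_reflect_sub (fun x => 1 / x) K, mul_sum]
  refine sum_le_sum fun n hn => ?_
  rw [mem_range] at hn
  have hKn : (0 : ℝ) < (K : ℝ) - n := by
    have : (n : ℝ) + 1 ≤ K := by exact_mod_cast hn
    linarith
  rw [mul_one_div, div_le_div_iff_of_pos_right hKn]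
  linarith [(mu_sub_mem hμ hn.le).1]

include hμ hH hF hT in
/-- **UPPER HALF**: `Tμ(K) ≤ F(K) + 2` — the terms `n < ⌊K∕2⌋` cost at most `⌊K∕2⌋∕(K − ⌊K∕2⌋) ≤ 1`, the terms `n ≥ ⌊K∕2⌋` at most `μ_{⌊K∕2⌋}·H_K`, and
`(μ_{⌊K∕2⌋} − μ_K)·H_K ≤ 1` by slow variation (`ln((K+1)∕(⌊K∕2⌋+1)) ≤ ln 2 ≤ 1`, `H_K ≤ 1 + ln(K+1)`, `√(1 + ln(K+1)) ≤ 2(1 + ln(⌊K∕2⌋+1))`). [folklore] -/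
theorem T_le_F_add_two (K : ℕ) : T K ≤ F K + 2 := by
  obtain ⟨hH0, _, _, hHhi, hHmono⟩ := harmonicR_facts hH
  set N := K / 2 with hN
  have hNK : N ≤ K := Nat.div_le_self K 2
  have hNN : N + N ≤ K := by omega
  have hK2N : K + 1 ≤ 2 * (N + 1) := by omega
  have hsumK : ∑ n ∈ range K, 1 / ((K : ℝ) - n) = H K := by
    rw [sum_range_reflect_sub (fun x => 1 / x) K, hH]
  have hHK0 : 0 ≤ H K := by rw [← hH0]; exact hHmono 0 K (Nat.zero_le K)
  -- first half ≤ 1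
  have h1 : ∑ n ∈ range N, μ n / ((K : ℝ) - n) ≤ 1 := by
    rcases Nat.eq_zero_or_pos N with hN0 | hNpos
    · rw [hN0]; simp
    have hNNr : (N : ℝ) + N ≤ K := by exact_mod_cast hNN
    have hKN : (0 : ℝ) < (K : ℝ) - N := by
      have : (0 : ℝ) < N := by exact_mod_cast hNpos
      linarith
    calc ∑ n ∈ range N, μ n / ((K : ℝ) - n) ≤ ∑ _n ∈ range N, 1 / ((K : ℝ) - N) := by
          refine sum_le_sum fun n hn => ?_
          rw [mem_range] at hn
          have hn' : (n : ℝ) ≤ N := by exact_mod_cast hn.le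
          have hKn : (0 : ℝ) < (K : ℝ) - n := by linarith
          obtain ⟨hμ0, hμ1⟩ := mu_pos_le_one hμ n
          rw [div_le_div_iff₀ hKn hKN]
          nlinarith
      _ = N / ((K : ℝ) - N) := by rw [sum_const, card_range, nsmul_eq_mul, mul_one_div]
      _ ≤ 1 := by rw [div_le_one hKN]; linarith
  -- second half ≤ μ_N · H_K
  have h2 : ∑ n ∈ Ico N K, μ n / ((K : ℝ) - n) ≤ μ N * H K := by
    calc ∑ n ∈ Ico N K, μ n / ((K : ℝ) - n) ≤ ∑ n ∈ Ico N K, μ N / ((K : ℝ) - n) := by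
          refine sum_le_sum fun n hn => ?_
          rw [Finset.mem_Ico] at hn
          have hKn : (0 : ℝ) < (K : ℝ) - n := by
            have : (n : ℝ) + 1 ≤ K := by exact_mod_cast hn.2
            linarith
          exact div_le_div_of_nonneg_right (by linarith [(mu_sub_mem hμ hn.1).1]) hKn.le
      _ ≤ ∑ n ∈ range K, μ N / ((K : ℝ) - n) := by
          refine sum_le_sum_of_subset_of_nonneg (fun n hn => ?_) fun n hn _ => ?_
          · rw [Finset.mem_Ico] at hn; exact mem_range.mpr hn.2
          · rw [mem_range] at hn
            have hKn : (0 : ℝ) < (K : ℝ) - n := by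
              have : (n : ℝ) + 1 ≤ K := by exact_mod_cast hn
              linarith
            exact div_nonneg (mu_pos_le_one hμ N).1.le hKn.le
      _ = μ N * H K := by
          rw [← hsumK, mul_sum]
          exact sum_congr rfl fun n _ => by rw [mul_one_div]
  -- slow variation: (μ_N − μ_K)·H_K ≤ 1
  have h3 : (μ N - μ K) * H K ≤ 1 := by
    obtain ⟨ha1, hab, _⟩ := one_le_logShift hNK
    obtain ⟨hd0, hd⟩ := mu_sub_mem hμ hNK
    set a := 1 + Real.log ((N : ℝ) + 1) with ha
    set b := 1 + Real.log ((K : ℝ) + 1) with hb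
    have hy1 : 1 ≤ Real.sqrt b := Real.one_le_sqrt.mpr (by linarith)
    have hy2 : Real.sqrt b ^ 2 = b := Real.sq_sqrt (by linarith)
    have hba' : Real.log ((K : ℝ) + 1) - Real.log ((N : ℝ) + 1) = b - a := by rw [ha, hb]; ring
    rw [hba'] at hd
    -- b − a ≤ ln 2 ≤ 1
    have hba : b - a ≤ 1 := by
      have hpos : (0 : ℝ) < (N : ℝ) + 1 := by positivity
      have e : b - a = Real.log (((K : ℝ) + 1) / ((N : ℝ) + 1)) := by
        rw [hb, ha, Real.log_div (by positivity) hpos.ne']; ring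
      have hq : ((K : ℝ) + 1) / ((N : ℝ) + 1) ≤ 2 := by
        rw [div_le_iff₀ hpos]; exact_mod_cast hK2N
      have hlog2 : Real.log 2 ≤ 1 := by
        have := Real.log_le_sub_one_of_pos (by norm_num : (0 : ℝ) < 2); linarith
      rw [e]
      exact (Real.log_le_log (by positivity) hq).trans hlog2
    -- H_K ≤ b
    have hHK : H K ≤ b := by
      have h2' : Real.log (K : ℝ) ≤ Real.log ((K : ℝ) + 1) := by
        rcases Nat.eq_zero_or_pos K with hK0 | hKpos
        · rw [hK0]; simp
        · exact Real.log_le_log (by exact_mod_cast hKpos) (by linarith)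
      rw [hb]; linarith [hHhi K]
    -- √b ≤ 2a (b ≤ a + 1 ≤ (2a)², a ≥ 1)
    have hyb : Real.sqrt b ≤ 2 * a := by nlinarith [hy2, hba, ha1, hy1]
    have hbb : Real.sqrt b * Real.sqrt b = b := Real.mul_self_sqrt (by linarith)
    calc (μ N - μ K) * H K ≤ (b - a) / (2 * a * Real.sqrt b) * b := mul_le_mul hd hHK hHK0 (le_trans hd0 hd)
      _ ≤ 1 := by
          rw [div_mul_eq_mul_div, div_le_one (by positivity)]
          calc (b - a) * b ≤ 1 * b := mul_le_mul_of_nonneg_right hba (by linarith)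
            _ = Real.sqrt b * Real.sqrt b := by rw [one_mul, hbb]
            _ ≤ 2 * a * Real.sqrt b := mul_le_mul_of_nonneg_right hyb (Real.sqrt_nonneg b)
  rw [hT, ← sum_range_add_sum_Ico _ hNK, hF]
  nlinarith [h1, h2, h3]

/-! ## §3 The one-loop proxy F: N3-win, steps, growth -/

include hμ hH hF in
/-- `F 0 = 0` and `0 ≤ F K ≤ H K`. [folklore] -/
theorem F_facts (K : ℕ) : F 0 = 0 ∧ 0 ≤ F K ∧ F K ≤ H K := by
  obtain ⟨hH0, _, _, _, hHmono⟩ := harmonicR_facts hH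
  obtain ⟨hμ0, hμ1⟩ := mu_pos_le_one hμ K
  have hHK0 : 0 ≤ H K := by rw [← hH0]; exact hHmono 0 K (Nat.zero_le K)
  refine ⟨by rw [hF, hH0, mul_zero], by rw [hF]; exact mul_nonneg hμ0.le hHK0, ?_⟩
  rw [hF]; nlinarith

include hμ hH hF in
/-- **N3-win FOR THE ONE-LOOP PROXY.**  For `n ≤ K`: `|F(K) − F(n)| ≤ 1 + (ln K − ln n)` (`Real.log 0 = 0` included): `F(K) − F(n) = μ_K(H_K − H_n) −
(μ_n − μ_K)H_n` with `0 ≤ μ_K(H_K − H_n) ≤ 1 + ln K − ln n` and `0 ≤ (μ_n − μ_K)H_n ≤ ln(K+1) − ln(n+1) ≤ ln K − ln n` (slow variation,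
`H_n ≤ 1 + ln(n+1)`; the case n = 0 has `H_0 = 0`). [folklore] -/
theorem window_F {n K : ℕ} (hn : n ≤ K) : |F K - F n| ≤ 1 + (Real.log K - Real.log n) := by
  obtain ⟨hH0, _, hHlo, hHhi, hHmono⟩ := harmonicR_facts hH
  obtain ⟨hμK0, hμK1⟩ := mu_pos_le_one hμ K
  obtain ⟨hd0, hd⟩ := mu_sub_mem hμ hn
  obtain ⟨ha1, hab, hx1⟩ := one_le_logShift hn
  have hHn0 : 0 ≤ H n := by rw [← hH0]; exact hHmono 0 n (Nat.zero_le n)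
  have hHKn : 0 ≤ H K - H n := by linarith [hHmono n K hn]
  have hlogK : Real.log (K : ℝ) ≤ Real.log ((K : ℝ) + 1) := by
    rcases Nat.eq_zero_or_pos K with hK0 | hKpos
    · rw [hK0]; simp
    · exact Real.log_le_log (by exact_mod_cast hKpos) (by linarith)
  have e : F K - F n = μ K * (H K - H n) - (μ n - μ K) * H n := by rw [hF, hF]; ring
  -- the n = 0 case: F n = 0
  rcases Nat.eq_zero_or_pos n with hn0 | hnpos
  · subst hn0
    have hF0 : H 0 = 0 := hH0
    have hHK0 : 0 ≤ H K := by linarith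
    rw [e, hF0, sub_zero, mul_zero, sub_zero, Nat.cast_zero, Real.log_zero, sub_zero, abs_of_nonneg (mul_nonneg hμK0.le hHK0)]
    calc μ K * H K ≤ 1 * H K := mul_le_mul_of_nonneg_right hμK1 hHK0
      _ ≤ 1 + Real.log K := by rw [one_mul]; exact hHhi K
  -- 1 ≤ n ≤ K
  have hn1 : (1 : ℝ) ≤ n := by exact_mod_cast hnpos
  have hlogn : Real.log ((n : ℝ) + 1) - Real.log (n : ℝ) ≤ 1 := by
    rw [← Real.log_div (by linarith) (by linarith)]
    have := Real.log_le_sub_one_of_pos (by positivity : (0 : ℝ) < ((n : ℝ) + 1) / n)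
    have e2 : ((n : ℝ) + 1) / n - 1 = 1 / n := by field_simp; ring
    rw [e2] at this
    exact this.trans ((div_le_one (by linarith)).mpr hn1)
  -- ln(K+1) − ln K ≤ ln(n+1) − ln n  (1/K ≤ 1/n)
  have hshift : Real.log ((K : ℝ) + 1) - Real.log ((n : ℝ) + 1) ≤ Real.log K - Real.log n := by
    have hK1 : (1 : ℝ) ≤ K := by exact_mod_cast (hnpos.trans_le hn)
    have hnK : (n : ℝ) ≤ K := by exact_mod_cast hn
    rw [← sub_nonneg]
    have e3 : Real.log (K : ℝ) - Real.log n - (Real.log ((K : ℝ) + 1) - Real.log ((n : ℝ) + 1)) =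
        Real.log ((K : ℝ) * ((n : ℝ) + 1) / (n * ((K : ℝ) + 1))) := by
      rw [Real.log_div (by positivity) (by positivity), Real.log_mul (by positivity) (by positivity),
        Real.log_mul (by positivity) (by positivity)]
      ring
    rw [e3]
    exact Real.log_nonneg (by rw [le_div_iff₀ (by positivity)]; nlinarith)
  -- first term ≤ 1 + ln K − ln n, second term ≤ ln K − ln n
  have h1 : μ K * (H K - H n) ≤ 1 + (Real.log K - Real.log n) := by
    calc μ K * (H K - H n) ≤ 1 * (H K - H n) := mul_le_mul_of_nonneg_right hμK1 hHKn
      _ ≤ 1 + (Real.log K - Real.log n) := by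
          have := hHlo n; have := hHhi K; linarith
  have h2 : (μ n - μ K) * H n ≤ Real.log K - Real.log n := by
    set a := 1 + Real.log ((n : ℝ) + 1) with ha
    set b := 1 + Real.log ((K : ℝ) + 1) with hb
    have hy1 : 1 ≤ Real.sqrt b := Real.one_le_sqrt.mpr (by linarith)
    have hHn : H n ≤ a := by
      have := hHhi n
      have : Real.log (n : ℝ) ≤ Real.log ((n : ℝ) + 1) := Real.log_le_log (by linarith) (by linarith)
      rw [ha]; linarith
    have hba0 : 0 ≤ b - a := by linarith
    have hba' : Real.log ((K : ℝ) + 1) - Real.log ((n : ℝ) + 1) = b - a := by rw [ha, hb]; ring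
    rw [hba'] at hd hshift
    calc (μ n - μ K) * H n ≤ (b - a) / (2 * a * Real.sqrt b) * a := mul_le_mul hd hHn hHn0 (le_trans hd0 hd)
      _ = (b - a) / (2 * Real.sqrt b) := by field_simp
      _ ≤ (b - a) / 1 := div_le_div_of_nonneg_left hba0 one_pos (by linarith)
      _ ≤ Real.log K - Real.log n := by rw [div_one]; exact hshift
  have h1' : 0 ≤ μ K * (H K - H n) := mul_nonneg hμK0.le hHKn
  have h2' : 0 ≤ (μ n - μ K) * H n := mul_nonneg hd0 hHn0
  rw [e, abs_le]
  constructor <;> linarith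

include hμ hH hF in
/-- **THE ONE-LOOP STEPS ARE NULL.**  `|F(n+1) − F(n)| ≤ 1∕(n+1)`: `F(n+1) − F(n) = μ_{n+1}∕(n+1) − (μ_n − μ_{n+1})H_n` with both terms in `[0, 1∕(n+1)]`
(slow variation and `ln(1 + 1∕(n+1)) ≤ 1∕(n+1)`). [folklore] -/
theorem F_step_le (n : ℕ) : |F (n + 1) - F n| ≤ 1 / ((n : ℝ) + 1) := by
  obtain ⟨hH0, hHsucc, _, hHhi, hHmono⟩ := harmonicR_facts hH
  obtain ⟨hμ0, hμ1⟩ := mu_pos_le_one hμ (n + 1)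
  obtain ⟨hd0, hd⟩ := mu_sub_mem hμ (Nat.le_succ n)
  obtain ⟨ha1, hab, _⟩ := one_le_logShift (Nat.le_succ n)
  have hHn0 : 0 ≤ H n := by rw [← hH0]; exact hHmono 0 n (Nat.zero_le n)
  have hn0 : (0 : ℝ) < (n : ℝ) + 1 := by positivity
  have e : F (n + 1) - F n = μ (n + 1) * (1 / ((n : ℝ) + 1)) - (μ n - μ (n + 1)) * H n := by
    rw [hF, hF, hHsucc]; ring
  have h1 : μ (n + 1) * (1 / ((n : ℝ) + 1)) ≤ 1 / ((n : ℝ) + 1) :=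
    (mul_le_mul_of_nonneg_right hμ1 (by positivity)).trans (by rw [one_mul])
  have h1' : 0 ≤ μ (n + 1) * (1 / ((n : ℝ) + 1)) := by positivity
  have h2 : (μ n - μ (n + 1)) * H n ≤ 1 / ((n : ℝ) + 1) := by
    set a := 1 + Real.log ((n : ℝ) + 1) with ha
    set b := 1 + Real.log ((((n + 1 : ℕ)) : ℝ) + 1) with hb
    have hy1 : 1 ≤ Real.sqrt b := Real.one_le_sqrt.mpr (by linarith)
    have hHn : H n ≤ a := by
      have := hHhi n
      have : Real.log (n : ℝ) ≤ Real.log ((n : ℝ) + 1) := by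
        rcases Nat.eq_zero_or_pos n with hz | hp
        · rw [hz]; simp
        · exact Real.log_le_log (by exact_mod_cast hp) (by linarith)
      rw [ha]; linarith
    have hba' : Real.log ((((n + 1 : ℕ)) : ℝ) + 1) - Real.log ((n : ℝ) + 1) = b - a := by rw [ha, hb]; ring
    rw [hba'] at hd
    -- b − a = ln((n+2)/(n+1)) ≤ 1/(n+1)
    have hba : b - a ≤ 1 / ((n : ℝ) + 1) := by
      have e2 : b - a = Real.log ((((n + 1 : ℕ) : ℝ) + 1) / ((n : ℝ) + 1)) := by
        rw [hb, ha, Real.log_div (by positivity) hn0.ne']; ring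
      rw [e2]
      have h := Real.log_le_sub_one_of_pos (by positivity : (0 : ℝ) < ((((n + 1 : ℕ) : ℝ) + 1) / ((n : ℝ) + 1)))
      have e3 : (((n + 1 : ℕ) : ℝ) + 1) / ((n : ℝ) + 1) - 1 = 1 / ((n : ℝ) + 1) := by push_cast; field_simp; ring
      linarith
    have hba0 : 0 ≤ b - a := by linarith
    calc (μ n - μ (n + 1)) * H n ≤ (b - a) / (2 * a * Real.sqrt b) * a := mul_le_mul hd hHn hHn0 (le_trans hd0 hd)
      _ = (b - a) / (2 * Real.sqrt b) := by field_simp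
      _ ≤ (b - a) / 1 := div_le_div_of_nonneg_left hba0 one_pos (by linarith)
      _ ≤ 1 / ((n : ℝ) + 1) := by rw [div_one]; exact hba
  have h2' : 0 ≤ (μ n - μ (n + 1)) * H n := mul_nonneg hd0 hHn0
  rw [e, abs_le]
  constructor <;> linarith

include hμ hH hF in
/-- **GROWTH OF F**: `√(1 + ln(K+1)) − 1 ≤ F(K) ≤ √(1 + ln(K+1))` (`H_K ≥ ln(K+1) = y² − 1`, `H_K ≤ 1 + ln K ≤ y²`, y = √(1 + ln(K+1)) ≥ 1). [folklore] -/
theorem F_bounds (K : ℕ) :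
    Real.sqrt (1 + Real.log ((K : ℝ) + 1)) - 1 ≤ F K ∧ F K ≤ Real.sqrt (1 + Real.log ((K : ℝ) + 1)) := by
  obtain ⟨_, _, hHlo, hHhi, _⟩ := harmonicR_facts hH
  obtain ⟨hb1, _, hy1⟩ := one_le_logShift (le_refl K)
  set b := 1 + Real.log ((K : ℝ) + 1) with hb
  set y := Real.sqrt b with hy
  have hy2 : y ^ 2 = b := Real.sq_sqrt (by linarith)
  have hy0 : 0 < y := by linarith
  have hlogK : Real.log (K : ℝ) ≤ Real.log ((K : ℝ) + 1) := by
    rcases Nat.eq_zero_or_pos K with hK0 | hKpos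
    · rw [hK0]; simp
    · exact Real.log_le_log (by exact_mod_cast hKpos) (by linarith)
  have hFK : F K = H K / y := by rw [hF, hμ K, ← hb, ← hy]; ring
  have hHlo' : y ^ 2 - 1 ≤ H K := by rw [hy2, hb]; linarith [hHlo K]
  have hHhi' : H K ≤ y ^ 2 := by rw [hy2, hb]; linarith [hHhi K]
  rw [hFK]
  constructor
  · rw [le_div_iff₀ hy0]; nlinarith
  · rw [div_le_iff₀ hy0]; nlinarith

end profile

end Summit.QuantumFields.BalabanUV.Beta.EriceRemainderEnclosureJointLetterProfile

end
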